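import Mathlib
import Literature.NumberTheory.LFunctions.Zhang2022.Section16TwoFactorValue
import HarnessLib

/-!
# Zhang (2022) §16 Lemma 16.2 (row G-d57-1), the `2`-factor at `s = 1` for `χ(2) = ±1`:
# part 1 — the finite-recurrence principle `N(x)·Σ_e u_e x^e = polynomial`

Topic `Literature/NumberTheory/LFunctions/Zhang2022` (Landau–Siegel audit tree; verdict-neutral).
Y. Zhang, *Discrete mean estimates and the Landau–Siegel zero*, arXiv:2211.02515v1 (2022)
[Zhang2022LandauSiegel] — **an unrefereed manuscript under adjudication; nothing here asserts or
denies its Theorems 1–2 or anything about Landau–Siegel zeros.** ZHANG-L discharge lane, WP16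
BLOCK D (Lemma 16.2; carve of record: zl-w09-p6 = "the prime 2"), item D-2e of WP09-PLAN §10.3,
branches `χ(2) = ±1`. By the planner's FINDING F-162R-cubic II (2026-08-27T01:39Z; CAS
`cas/cubic162.py`), for every `β` the repaired local factor `Φ_q(x) = N_q(x)·C_q(x)`,
`C_q(x) = Σ_e ϖ(q^e)(ν∗χ)(q^e)x^e`, `N_q(x) = (1−x)²(1−zx)(1−vx)(1−vzx)²`, is a POLYNOMIAL in `x`:
the coefficient sequence `u_e = ϖ(q^e)(ν∗χ)(q^e)` satisfies, from some index on, the linear recurrence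
whose characteristic polynomial is `N_q` (App. A p. 105: the local series are eventually geometric in
`z^e`, and `(ν∗χ)(q^e)` is polynomial / signed-polynomial in `e`).

THIS FILE (part 1) proves the bookkeeping principle behind it, ONCE, for any coefficient sequence:

* `poly_mul_tsum_eq_sum_of_recurrence` — if `Σ_e u_e x^e` converges and
  `Σ_{k ≤ min(n,d)} N_k u_{n−k} = 0` for all `n ≥ n₀`, then
  `(Σ_{k≤d} N_k x^k)·(Σ_e u_e x^e) = Σ_{n<n₀} (Σ_{k≤min(n,d)} N_k u_{n−k}) x^n` — a finite sum;

so the value of the `2`-factor at `x = ½` becomes FINITE algebra in the local data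
(`G_{ab} = F₂(2^a,2^b;1−β_j)`, `λ₂(2)`, `z = 2^{β_j}`), to be compared with its `β = 0` value
(`3/8`, `9/16`) coefficient by coefficient (parts 2–3).

Theorem-only; no definitions, no new facts.

## References

* Y. Zhang, arXiv:2211.02515v1 (2022), §16 Lemma 16.2 p. 94; App. A p. 105.
  [cite: Zhang2022LandauSiegel, §16 Lemma 16.2 p.94; App. A p.105]
-/

noncomputable section

open Complex Real Finset

namespace Literature.NumberTheory.LFunctions.Zhang2022.Typed.Section16B

/-! ## The finite-recurrence principle -/

/-- Shifting a convergent power series by `x^k`: `Σ' n, [k ≤ n]·N·u_{n−k}·x^n = N·x^k·Σ' e, u_e x^e`,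
and the shifted family is summable. [cite: Zhang2022LandauSiegel, App. A p.105] -/
theorem tsum_shift_eq {u : ℕ → ℂ} {x : ℂ} (hu : Summable fun e => u e * x ^ e) (N : ℂ) (k : ℕ) :
    Summable (fun n => if k ≤ n then N * u (n - k) * x ^ n else 0) ∧
      (∑' n, (if k ≤ n then N * u (n - k) * x ^ n else 0)) = N * x ^ k * ∑' e, u e * x ^ e := by
  set g : ℕ → ℂ := fun n => if k ≤ n then N * u (n - k) * x ^ n else 0 with hg
  have hshift : ∀ e, g (e + k) = N * x ^ k * (u e * x ^ e) := by
    intro e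
    rw [hg]; dsimp only
    rw [if_pos (Nat.le_add_left k e), Nat.add_sub_cancel, pow_add]
    ring
  have hsum' : Summable fun e => g (e + k) := by
    simp_rw [hshift]; exact hu.mul_left _
  have hsum : Summable g := (summable_nat_add_iff k).mp hsum'
  refine ⟨hsum, ?_⟩
  have hsplit := (hsum.sum_add_tsum_nat_add k).symm
  have hzero : ∑ i ∈ Finset.range k, g i = 0 := by
    refine Finset.sum_eq_zero fun i hi => ?_
    rw [hg]; dsimp only
    rw [if_neg (not_le.mpr (Finset.mem_range.mp hi))]
  rw [hsplit, hzero, zero_add]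
  simp_rw [hshift]
  exact tsum_mul_left

/-- **The finite-recurrence principle.** If `Σ_e u_e x^e` converges and the coefficients satisfy the
linear recurrence `Σ_{k ≤ min(n,d)} N_k u_{n−k} = 0` for every `n ≥ n₀`, then
`(Σ_{k≤d} N_k x^k)·(Σ_e u_e x^e) = Σ_{n<n₀} (Σ_{k≤min(n,d)} N_k u_{n−k}) x^n` (a polynomial in `x`).
[cite: Zhang2022LandauSiegel, App. A p.105] -/
theorem poly_mul_tsum_eq_sum_of_recurrence {u : ℕ → ℂ} {x : ℂ} (hu : Summable fun e => u e * x ^ e)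
    (N : ℕ → ℂ) (d n₀ : ℕ)
    (hrec : ∀ n, n₀ ≤ n →
      ∑ k ∈ Finset.range (d + 1), (if k ≤ n then N k * u (n - k) else 0) = 0) :
    (∑ k ∈ Finset.range (d + 1), N k * x ^ k) * (∑' e, u e * x ^ e) =
      ∑ n ∈ Finset.range n₀,
        (∑ k ∈ Finset.range (d + 1), (if k ≤ n then N k * u (n - k) else 0)) * x ^ n := by
  -- each shifted series
  have hk := fun k => tsum_shift_eq hu (N k) k
  -- LHS as a series of the combined coefficients
  have h1 : (∑ k ∈ Finset.range (d + 1), N k * x ^ k) * (∑' e, u e * x ^ e) =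
      ∑ k ∈ Finset.range (d + 1), ∑' n, (if k ≤ n then N k * u (n - k) * x ^ n else 0) := by
    rw [Finset.sum_mul]
    exact Finset.sum_congr rfl fun k _ => ((hk k).2).symm
  have h2 : ∑ k ∈ Finset.range (d + 1), ∑' n, (if k ≤ n then N k * u (n - k) * x ^ n else 0) =
      ∑' n, ∑ k ∈ Finset.range (d + 1), (if k ≤ n then N k * u (n - k) * x ^ n else 0) :=
    (Summable.tsum_finsetSum (fun k _ => (hk k).1)).symm
  have h3 : ∀ n, ∑ k ∈ Finset.range (d + 1), (if k ≤ n then N k * u (n - k) * x ^ n else 0) =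
      (∑ k ∈ Finset.range (d + 1), (if k ≤ n then N k * u (n - k) else 0)) * x ^ n := by
    intro n
    rw [Finset.sum_mul]
    refine Finset.sum_congr rfl fun k _ => ?_
    split_ifs <;> simp
  rw [h1, h2, tsum_congr h3]
  -- the coefficients vanish from `n₀` on
  refine tsum_eq_sum fun n hn => ?_
  rw [hrec n (not_lt.mp fun h => hn (Finset.mem_range.mpr h)), zero_mul]


/-! ## Part 2 (`χ(2) = 1`, the STAR branch): the coefficient sequence satisfies the `N`-recurrence -/

section Star

open Literature.NumberTheory.LFunctions.Zhang2022
open Literature.NumberTheory.LFunctions.Zhang2022.Skeleton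
open Literature.NumberTheory.LFunctions.Zhang2022.Typed.Section16A

variable (c' : ℝ) {D : ℕ} (χ : DirichletCharacter ℂ D)

/-- The geometric block `S_m = Σ_{1 ≤ a < m} z^a` shifts as `S_{m+r} = S_m + z^m Σ_{i<r} z^i` (`m ≥ 1`).
[folklore] -/
private theorem sum_Ico_pow_shift (z : ℂ) {m : ℕ} (hm : 1 ≤ m) (r : ℕ) :
    ∑ a ∈ Finset.Ico 1 (m + r), z ^ a =
      ∑ a ∈ Finset.Ico 1 m, z ^ a + z ^ m * ∑ i ∈ Finset.range r, z ^ i := by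
  induction r with
  | zero => simp
  | succ r ih =>
    rw [← Nat.add_assoc, Finset.sum_Ico_succ_top (by omega : 1 ≤ m + r), ih, Finset.sum_range_succ,
      pow_add]
    ring

/-- **`2ϖ₂ⱼ(2^e) = G₀₁ + λ₂(2)G₁₁S_e + λ₂(2)G₁₀z^e` for `e ≥ 1` when `χ(2) = 1`** (`F*₂ = 2`; from D-2b:
the divisor pairs `(1,2^e)`, `(2^a,2^{e−a})` with `1 ≤ a ≤ e−1`, `(2^e,1)`, the factor `F₂(d,l)` depending
only on `(2∣d, 2∣l)`; `z = 2^{β_j}`, `S_e = Σ_{1≤a<e} z^a`). [cite: Zhang2022LandauSiegel, §16 p.93 (u030)] -/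
theorem two_mul_varpi2_two_pow_of_apply_eq_one (hv : χ (2 : ZMod D) = 1) (j : ℕ)
    (hstar : calM2star c' χ (1 - betaJ c' D j) ≠ 0) {e : ℕ} (he : 1 ≤ e) :
    2 * varpi2 c' χ j (2 ^ e) =
      calM2Factor c' χ 2 1 2 (1 - betaJ c' D j) +
        lam2 c' χ 2 1 * calM2Factor c' χ 2 2 2 (1 - betaJ c' D j) *
          (∑ a ∈ Finset.Ico 1 e, ((2 : ℂ) ^ betaJ c' D j) ^ a) +
        lam2 c' χ 2 1 * calM2Factor c' χ 2 2 1 (1 - betaJ c' D j) * ((2 : ℂ) ^ betaJ c' D j) ^ e := by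
  classical
  set s : ℂ := 1 - betaJ c' D j with hs
  set z : ℂ := (2 : ℂ) ^ betaJ c' D j with hz
  have hs0 : 0 < s.re := by simp [hs, betaJ_re_eq_zero c' D j]
  have hv' : χ ((2 : ℕ) : ZMod D) = 1 := by exact_mod_cast hv
  have hnot : ¬ (χ (2 : ZMod D) ≠ 1) := not_not.mpr hv
  have hF : χ (2 : ZMod D) ≠ 1 → calM2Factor c' χ 2 1 1 s ≠ 0 := fun h => absurd hv h
  -- powers of `2` under `χ` and `β_j`
  have hchi : ∀ b : ℕ, χ ((2 ^ b : ℕ) : ZMod D) = 1 := fun b => by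
    rw [Nat.cast_pow, map_pow, hv', one_pow]
  have hzpow : ∀ a : ℕ, ((2 ^ a : ℕ) : ℂ) ^ betaJ c' D j = z ^ a := fun a => by
    induction a with
    | zero => simp
    | succ n ih => rw [pow_succ, Nat.cast_mul, Complex.natCast_mul_natCast_cpow, ih, hz, pow_succ]; norm_num
  -- the three kinds of local factors
  have hG01 : ∀ b : ℕ, 1 ≤ b → calM2Factor c' χ 2 1 (2 ^ b) s = calM2Factor c' χ 2 1 2 s := fun b hb =>
    Section16CalM2Euler.calM2Factor_congr c' χ Nat.prime_two hs0 Iff.rfl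
      ⟨fun _ => dvd_rfl, fun _ => dvd_pow_self 2 (by omega)⟩
  have hG10 : ∀ a : ℕ, 1 ≤ a → calM2Factor c' χ 2 (2 ^ a) 1 s = calM2Factor c' χ 2 2 1 s := fun a ha =>
    Section16CalM2Euler.calM2Factor_congr c' χ Nat.prime_two hs0
      ⟨fun _ => dvd_rfl, fun _ => dvd_pow_self 2 (by omega)⟩ Iff.rfl
  have hG11 : ∀ a b : ℕ, 1 ≤ a → 1 ≤ b →
      calM2Factor c' χ 2 (2 ^ a) (2 ^ b) s = calM2Factor c' χ 2 2 2 s := fun a b ha hb =>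
    Section16CalM2Euler.calM2Factor_congr c' χ Nat.prime_two hs0
      ⟨fun _ => dvd_rfl, fun _ => dvd_pow_self 2 (by omega)⟩
      ⟨fun _ => dvd_rfl, fun _ => dvd_pow_self 2 (by omega)⟩
  have hlam : ∀ a : ℕ, 1 ≤ a → lam2 c' χ (2 ^ a) 1 = lam2 c' χ 2 1 := fun a ha => by
    rw [Lemma162R.lam2_prime_pow c' χ Nat.prime_two a 1, if_neg (by omega)]
  -- D-2b, as a sum over `a ∈ range (e+1)`
  rw [varpi2_two_pow c' χ j e hstar hF, if_neg hnot,
    Nat.sum_divisorsAntidiagonal (f := fun d l => lam2 c' χ d 1 * (d : ℂ) ^ betaJ c' D j *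
      χ (l : ZMod D) * calM2Factor c' χ 2 d l s),
    Nat.divisors_prime_pow Nat.prime_two, Finset.sum_map]
  simp only [Function.Embedding.coeFn_mk]
  have hterm : ∀ a ∈ Finset.range (e + 1),
      lam2 c' χ (2 ^ a) 1 * ((2 ^ a : ℕ) : ℂ) ^ betaJ c' D j * χ ((2 ^ e / 2 ^ a : ℕ) : ZMod D) *
          calM2Factor c' χ 2 (2 ^ a) (2 ^ e / 2 ^ a) s =
        lam2 c' χ (2 ^ a) 1 * z ^ a * calM2Factor c' χ 2 (2 ^ a) (2 ^ (e - a)) s := by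
    intro a ha
    have ha' : a ≤ e := Nat.lt_succ_iff.mp (Finset.mem_range.mp ha)
    rw [Nat.pow_div ha' (by norm_num), hchi, hzpow, mul_one]
  rw [Finset.sum_congr rfl hterm]
  -- split off `a = 0` and `a = e`
  rw [Finset.sum_range_succ, Finset.range_eq_Ico, Finset.sum_eq_sum_Ico_succ_bot (by omega : 0 < e)]
  have hl1 : lam2 c' χ 1 1 = 1 := by
    have h := Lemma162R.lam2_prime_pow c' χ Nat.prime_two 0 1
    rwa [pow_zero, if_pos rfl] at h
  rw [pow_zero, Nat.sub_zero, pow_zero, mul_one, Nat.sub_self, pow_zero, hl1, one_mul, hG01 e he,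
    hlam e he, hG10 e he]
  have hmid : ∑ a ∈ Finset.Ico (0 + 1) e, lam2 c' χ (2 ^ a) 1 * z ^ a * calM2Factor c' χ 2 (2 ^ a) (2 ^ (e - a)) s =
      lam2 c' χ 2 1 * calM2Factor c' χ 2 2 2 s * ∑ a ∈ Finset.Ico 1 e, z ^ a := by
    rw [zero_add, Finset.mul_sum]
    refine Finset.sum_congr rfl fun a ha => ?_
    obtain ⟨ha1, hae⟩ := Finset.mem_Ico.mp ha
    rw [hlam a ha1, hG11 a (e - a) ha1 (by omega)]
    ring
  rw [hmid]
  ring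

/-- The formal identity behind the recurrence (`v = 1`): with `N(y) = (1−y)³(1−zy)³ = Σ_{k≤6} N_k y^k`
and `2u_m = (G₀₁ + C·S_m + B·z^m)·(m+2)(m+1)/2`, `S_{m+r} = S + Z·Σ_{i<r}z^i`, `z^{m+r} = Z z^r`
(`m ≥ 1`, `Z = z^m`, `S = S_m`): `Σ_{r≤6} N_{6−r}·u_{m+r} = 0` identically. [folklore: polynomial identity] -/
private theorem star_recurrence_identity (A B C z Z S μ : ℂ) :
    (z ^ 3) * ((A + C * S + B * Z) * ((μ + 2) * (μ + 1) / 2)) +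
    (-3 * z ^ 2 - 3 * z ^ 3) * ((A + C * (S + Z * 1) + B * (Z * z)) * ((μ + 3) * (μ + 2) / 2)) +
    (3 * z + 9 * z ^ 2 + 3 * z ^ 3) *
      ((A + C * (S + Z * (1 + z)) + B * (Z * z ^ 2)) * ((μ + 4) * (μ + 3) / 2)) +
    (-1 - 9 * z - 9 * z ^ 2 - z ^ 3) *
      ((A + C * (S + Z * (1 + z + z ^ 2)) + B * (Z * z ^ 3)) * ((μ + 5) * (μ + 4) / 2)) +
    (3 + 9 * z + 3 * z ^ 2) *
      ((A + C * (S + Z * (1 + z + z ^ 2 + z ^ 3)) + B * (Z * z ^ 4)) * ((μ + 6) * (μ + 5) / 2)) +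
    (-3 - 3 * z) *
      ((A + C * (S + Z * (1 + z + z ^ 2 + z ^ 3 + z ^ 4)) + B * (Z * z ^ 5)) * ((μ + 7) * (μ + 6) / 2)) +
    1 * ((A + C * (S + Z * (1 + z + z ^ 2 + z ^ 3 + z ^ 4 + z ^ 5)) + B * (Z * z ^ 6)) *
      ((μ + 8) * (μ + 7) / 2)) = 0 := by
  ring

end Star


section StarFinite

open Literature.NumberTheory.LFunctions.Zhang2022
open Literature.NumberTheory.LFunctions.Zhang2022.Skeleton
open Literature.NumberTheory.LFunctions.Zhang2022.Typed.Section16A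

variable (c' : ℝ) {D : ℕ} (χ : DirichletCharacter ℂ D)

/-- Summability of the `2`-factor series at `y = ½` from `|ϖ₂ⱼ(2^e)| ≤ B(e+1)` and
`|(ν∗χ)(2^e)| = C(e+2,2) ≤ (e+1)²`. [cite: Zhang2022LandauSiegel, §16 Lemma 16.2 p.94] -/
theorem summable_twoFactor_series (hv : χ (2 : ZMod D) = 1) (j : ℕ) {B : ℝ}
    (hB : ∀ e : ℕ, ‖varpi2 c' χ j (2 ^ e)‖ ≤ B * ((e : ℝ) + 1)) :
    Summable fun e : ℕ =>
      varpi2 c' χ j (2 ^ e) * nuConvChi χ (2 ^ e) * ((2 : ℂ) ^ (-(1 : ℂ))) ^ e := by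
  have hv' : χ ((2 : ℕ) : ZMod D) = 1 := by exact_mod_cast hv
  have hB0 : 0 ≤ B := by
    have h := hB 0
    have : (0 : ℝ) ≤ ‖varpi2 c' χ j (2 ^ 0)‖ := norm_nonneg _
    nlinarith
  have hy : ‖(2 : ℂ) ^ (-(1 : ℂ))‖ = 1 / 2 := by
    rw [Complex.cpow_neg_one, norm_inv, Complex.norm_ofNat]; norm_num
  -- the majorant `B (e+1)^3 (1/2)^e`
  have hg0 : Summable fun n : ℕ => ((n : ℝ)) ^ 3 * (1 / 2 : ℝ) ^ n :=
    summable_pow_mul_geometric_of_norm_lt_one 3 (by rw [Real.norm_eq_abs, abs_of_pos (by norm_num)]; norm_num)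
  have hg1 : Summable fun e : ℕ => (((e + 1 : ℕ) : ℝ)) ^ 3 * (1 / 2 : ℝ) ^ (e + 1) :=
    (summable_nat_add_iff 1).mpr hg0
  have hg : Summable fun e : ℕ => B * (((e : ℝ) + 1) ^ 3 * (1 / 2 : ℝ) ^ e) := by
    refine ((hg1.mul_left 2).mul_left B).congr fun e => ?_
    push_cast
    ring
  refine Summable.of_norm_bounded hg fun e => ?_
  rw [norm_mul, norm_mul, norm_pow, hy, nuConvChi_prime_pow_of_apply_eq_one χ Nat.prime_two hv' e,
    Complex.norm_natCast]
  have hc : (((e + 2).choose 2 : ℕ) : ℝ) ≤ ((e : ℝ) + 1) ^ 2 := by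
    rw [Nat.cast_choose_two]; push_cast
    rw [div_le_iff₀ (by norm_num : (0 : ℝ) < 2)]
    nlinarith
  have he1 : (0 : ℝ) ≤ (e : ℝ) + 1 := by positivity
  calc ‖varpi2 c' χ j (2 ^ e)‖ * (((e + 2).choose 2 : ℕ) : ℝ) * (1 / 2 : ℝ) ^ e
      ≤ (B * ((e : ℝ) + 1)) * ((e : ℝ) + 1) ^ 2 * (1 / 2 : ℝ) ^ e := by
        apply mul_le_mul_of_nonneg_right _ (by positivity)
        exact mul_le_mul (hB e) hc (Nat.cast_nonneg _) (by positivity)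
    _ = B * (((e : ℝ) + 1) ^ 3 * (1 / 2 : ℝ) ^ e) := by ring

/-- **The `2`-factor at `s = 1` is FINITE algebra (`χ(2) = 1`).** With `y = ½`, `z = 2^{β_j}`,
`u_e = ϖ₂ⱼ(2^e)(ν∗χ)(2^e)` and `N(y) = (1−y)³(1−zy)³ = Σ_{k≤6}N_k y^k`:
`N(½)·Σ_e u_e ½^e = Σ_{n≤6} (Σ_{k≤n} N_k u_{n−k}) ½^n` — the series coefficients obey the
`N`-recurrence from `n = 7` on (`two_mul_varpi2_two_pow_of_apply_eq_one` + the formal identity).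
[cite: Zhang2022LandauSiegel, §16 Lemma 16.2 p.94; App. A p.105] -/
theorem twoFactor_star_finite (hv : χ (2 : ZMod D) = 1) (j : ℕ)
    (hstar : calM2star c' χ (1 - betaJ c' D j) ≠ 0) {B : ℝ}
    (hB : ∀ e : ℕ, ‖varpi2 c' χ j (2 ^ e)‖ ≤ B * ((e : ℝ) + 1)) :
    ((1 - (2 : ℂ) ^ (-(1 : ℂ))) ^ 3 * (1 - (2 : ℂ) ^ betaJ c' D j * (2 : ℂ) ^ (-(1 : ℂ))) ^ 3) *
        (∑' e : ℕ, varpi2 c' χ j (2 ^ e) * nuConvChi χ (2 ^ e) * ((2 : ℂ) ^ (-(1 : ℂ))) ^ e) =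
      ∑ n ∈ Finset.range 7,
        (∑ k ∈ Finset.range 7,
          (if k ≤ n then
            (if k = 0 then (1 : ℂ) else if k = 1 then -3 - 3 * (2 : ℂ) ^ betaJ c' D j
              else if k = 2 then 3 + 9 * (2 : ℂ) ^ betaJ c' D j + 3 * ((2 : ℂ) ^ betaJ c' D j) ^ 2
              else if k = 3 then -1 - 9 * (2 : ℂ) ^ betaJ c' D j - 9 * ((2 : ℂ) ^ betaJ c' D j) ^ 2 -
                ((2 : ℂ) ^ betaJ c' D j) ^ 3
              else if k = 4 then 3 * (2 : ℂ) ^ betaJ c' D j + 9 * ((2 : ℂ) ^ betaJ c' D j) ^ 2 +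
                3 * ((2 : ℂ) ^ betaJ c' D j) ^ 3
              else if k = 5 then -3 * ((2 : ℂ) ^ betaJ c' D j) ^ 2 - 3 * ((2 : ℂ) ^ betaJ c' D j) ^ 3
              else ((2 : ℂ) ^ betaJ c' D j) ^ 3) *
              (varpi2 c' χ j (2 ^ (n - k)) * nuConvChi χ (2 ^ (n - k)))
          else 0)) * ((2 : ℂ) ^ (-(1 : ℂ))) ^ n := by
  classical
  set y : ℂ := (2 : ℂ) ^ (-(1 : ℂ)) with hy
  set z : ℂ := (2 : ℂ) ^ betaJ c' D j with hz
  set N : ℕ → ℂ := fun k => if k = 0 then (1 : ℂ) else if k = 1 then -3 - 3 * z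
      else if k = 2 then 3 + 9 * z + 3 * z ^ 2 else if k = 3 then -1 - 9 * z - 9 * z ^ 2 - z ^ 3
      else if k = 4 then 3 * z + 9 * z ^ 2 + 3 * z ^ 3 else if k = 5 then -3 * z ^ 2 - 3 * z ^ 3
      else z ^ 3 with hN
  set u : ℕ → ℂ := fun e => varpi2 c' χ j (2 ^ e) * nuConvChi χ (2 ^ e) with hu
  have hv' : χ ((2 : ℕ) : ZMod D) = 1 := by exact_mod_cast hv
  -- `N(y)` expanded
  have hpoly : (1 - y) ^ 3 * (1 - z * y) ^ 3 = ∑ k ∈ Finset.range 7, N k * y ^ k := by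
    simp only [hN, Finset.sum_range_succ, Finset.sum_range_zero]
    norm_num
    ring
  -- summability
  have hsum : Summable fun e => u e * y ^ e := summable_twoFactor_series c' χ hv j hB
  -- the recurrence from `n = 7` on
  have hrec : ∀ n, 7 ≤ n →
      ∑ k ∈ Finset.range (6 + 1), (if k ≤ n then N k * u (n - k) else 0) = 0 := by
    intro n hn
    obtain ⟨m, rfl⟩ : ∃ m, n = m + 1 + 6 := ⟨n - 7, by omega⟩
    have hm : 1 ≤ m + 1 := by omega
    -- the coefficients `u_{m+1+r}`, `r ≤ 6`, in closed form
    set A : ℂ := calM2Factor c' χ 2 1 2 (1 - betaJ c' D j) with hA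
    set Bc : ℂ := lam2 c' χ 2 1 * calM2Factor c' χ 2 2 1 (1 - betaJ c' D j) with hBc
    set C : ℂ := lam2 c' χ 2 1 * calM2Factor c' χ 2 2 2 (1 - betaJ c' D j) with hC
    set S : ℂ := ∑ a ∈ Finset.Ico 1 (m + 1), z ^ a with hS
    set Z : ℂ := z ^ (m + 1) with hZ
    have hur : ∀ r : ℕ, u (m + 1 + r) =
        (1 / 2 : ℂ) * (A + C * (S + Z * ∑ i ∈ Finset.range r, z ^ i) + Bc * (Z * z ^ r)) *
          ((((m + 1 : ℕ) : ℂ) + r + 2) * ((((m + 1 : ℕ)) : ℂ) + r + 1) / 2) := by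
      intro r
      have h2 := two_mul_varpi2_two_pow_of_apply_eq_one c' χ hv j hstar (e := m + 1 + r) (by omega)
      have hw : varpi2 c' χ j (2 ^ (m + 1 + r)) =
          (1 / 2 : ℂ) * (A + C * (S + Z * ∑ i ∈ Finset.range r, z ^ i) + Bc * (Z * z ^ r)) := by
        rw [hA, hC, hBc, hS, hZ, ← sum_Ico_pow_shift z hm r, ← pow_add]
        linear_combination (1 / 2 : ℂ) * h2
      rw [hu]; dsimp only
      rw [hw, nuConvChi_prime_pow_of_apply_eq_one χ Nat.prime_two hv' (m + 1 + r), Nat.cast_choose_two]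
      push_cast
      ring
    -- all guards are true; expand and use the formal identity
    have hk : ∀ k ∈ Finset.range (6 + 1),
        (if k ≤ m + 1 + 6 then N k * u (m + 1 + 6 - k) else 0) = N k * u (m + 1 + 6 - k) := by
      intro k hk
      rw [if_pos (by have := Finset.mem_range.mp hk; omega)]
    rw [Finset.sum_congr rfl hk]
    simp only [Finset.sum_range_succ, Finset.sum_range_zero, zero_add]
    rw [show m + 1 + 6 - 0 = m + 1 + 6 by omega, show m + 1 + 6 - 1 = m + 1 + 5 by omega,
      show m + 1 + 6 - 2 = m + 1 + 4 by omega, show m + 1 + 6 - 3 = m + 1 + 3 by omega,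
      show m + 1 + 6 - 4 = m + 1 + 2 by omega, show m + 1 + 6 - 5 = m + 1 + 1 by omega,
      show m + 1 + 6 - 6 = m + 1 + 0 by omega,
      hur 6, hur 5, hur 4, hur 3, hur 2, hur 1, hur 0]
    simp only [hN, Finset.sum_range_succ, Finset.sum_range_zero]
    norm_num
    ring
  have key := poly_mul_tsum_eq_sum_of_recurrence hsum N 6 7 hrec
  rw [hpoly]
  rw [key]

end StarFinite


/-! ## Part 3 (`χ(2) = 1`): the value at `s = 1` in closed form, and the `O(α)` comparison with `3/8` -/

section StarValue

open Literature.NumberTheory.LFunctions.Zhang2022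
open Literature.NumberTheory.LFunctions.Zhang2022.Skeleton
open Literature.NumberTheory.LFunctions.Zhang2022.Typed.Section16A

variable (c' : ℝ) {D : ℕ} (χ : DirichletCharacter ℂ D)

/-- **The `2`-factor at `s = 1` in closed form (`χ(2) = 1`)**: with `z = 2^{β_j}`, `w = 2^{−β₁}`,
`N₂(½)·Σ_e ϖ₂ⱼ(2^e)(ν∗χ)(2^e)2^{−e} = 3/8 + [(w−1)·Q₁(z) + (z−1)(z−2)/8]/(2−z)`,
`Q₁(z) = (z/2)(1−z/2)² − (1−z)/8 + (1−7z+5z²−z³)/8` — exact finite algebra from `twoFactor_star_finite`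
and the closed forms of `F₂(2^a,2^b;1−β_j)` (`calM2Factor_prime_eq`); at `β = 0` (`w = z = 1`) the
value is `3/8`, the `q = 2` factor of the main term. [cite: Zhang2022LandauSiegel, §16 Lemma 16.2 p.94; App. A p.105] -/
theorem twoFactor_star_eq (hv : χ (2 : ZMod D) = 1) (j : ℕ)
    (hstar : calM2star c' χ (1 - betaJ c' D j) ≠ 0) {B : ℝ}
    (hB : ∀ e : ℕ, ‖varpi2 c' χ j (2 ^ e)‖ ≤ B * ((e : ℝ) + 1)) :
    ((1 - (2 : ℂ) ^ (-(1 : ℂ))) ^ 3 * (1 - (2 : ℂ) ^ betaJ c' D j * (2 : ℂ) ^ (-(1 : ℂ))) ^ 3) *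
        (∑' e : ℕ, varpi2 c' χ j (2 ^ e) * nuConvChi χ (2 ^ e) * ((2 : ℂ) ^ (-(1 : ℂ))) ^ e) =
      3 / 8 + (((2 : ℂ) ^ (-beta1 c' D) - 1) *
          ((2 : ℂ) ^ betaJ c' D j / 2 * (1 - (2 : ℂ) ^ betaJ c' D j / 2) ^ 2 -
            (1 - (2 : ℂ) ^ betaJ c' D j) / 8 +
            (1 - 7 * (2 : ℂ) ^ betaJ c' D j + 5 * ((2 : ℂ) ^ betaJ c' D j) ^ 2 -
              ((2 : ℂ) ^ betaJ c' D j) ^ 3) / 8) +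
        ((2 : ℂ) ^ betaJ c' D j - 1) * ((2 : ℂ) ^ betaJ c' D j - 2) / 8) / (2 - (2 : ℂ) ^ betaJ c' D j) := by
  classical
  rw [twoFactor_star_finite c' χ hv j hstar hB]
  set s : ℂ := 1 - betaJ c' D j with hs
  set z : ℂ := (2 : ℂ) ^ betaJ c' D j with hz
  set w : ℂ := (2 : ℂ) ^ (-beta1 c' D) with hw
  have hv' : χ ((2 : ℕ) : ZMod D) = 1 := by exact_mod_cast hv
  have hs0 : 0 < s.re := by simp [hs, betaJ_re_eq_zero c' D j]
  -- unimodularity and the basic non-vanishings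
  have hznorm : ‖z‖ = 1 := by
    rw [hz, show (2 : ℂ) = ((2 : ℕ) : ℂ) by norm_num,
      Complex.norm_natCast_cpow_of_pos (by norm_num : 0 < 2), betaJ_re_eq_zero c' D j, Real.rpow_zero]
  have hwnorm : ‖w‖ = 1 := by
    obtain ⟨h, -⟩ := AppendixA.norm_cpow_neg_beta1 c' (D := D) (q := 2) (by norm_num)
    rw [hw, show (2 : ℂ) = ((2 : ℕ) : ℂ) by norm_num]; exact h
  have hne_of_norm : ∀ {t : ℂ} {c : ℝ}, ‖t‖ = c → c < 1 → (1 : ℂ) - t ≠ 0 := by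
    intro t c ht hc h
    have : t = 1 := by linear_combination -h
    rw [this, norm_one] at ht
    linarith
  have h2z : (2 : ℂ) - z ≠ 0 := by
    intro h
    have : z = 2 := by linear_combination -h
    rw [this, Complex.norm_ofNat] at hznorm; norm_num at hznorm
  have h1x : (1 : ℂ) - z / 2 ≠ 0 :=
    hne_of_norm (by rw [norm_div, hznorm, Complex.norm_ofNat]) (by norm_num)
  have h1wx : (1 : ℂ) - w * (z / 2) ≠ 0 :=
    hne_of_norm (by rw [norm_mul, norm_div, hwnorm, hznorm, Complex.norm_ofNat]) (by norm_num)
  have h1w2 : (1 : ℂ) - w * ((1 : ℂ) / 2) ≠ 0 :=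
    hne_of_norm (by rw [norm_mul, hwnorm, norm_div, norm_one, Complex.norm_ofNat]) (by norm_num)
  have h1w2' : (1 : ℂ) - 1 * w / 2 ≠ 0 := by
    intro h; apply h1w2; linear_combination h
  have h2w : (2 : ℂ) - w ≠ 0 := by
    intro h; apply h1w2; linear_combination h / 2
  have h2wz : (2 : ℂ) - w * z ≠ 0 := by
    intro h; apply h1wx; linear_combination h / 2
  -- `x = 2^{−s} = z/2`
  have hxz : ((2 : ℕ) : ℂ) ^ (-s) = z / 2 := by
    rw [Nat.cast_ofNat, hs, neg_sub, Complex.cpow_sub _ _ two_ne_zero, Complex.cpow_one, hz]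
  have hx1 : ‖((2 : ℕ) : ℂ) ^ (-s)‖ < 1 := by
    rw [hxz, norm_div, hznorm, Complex.norm_ofNat]; norm_num
  have hw2 : ((2 : ℕ) : ℂ) ^ (-beta1 c' D) = w := by rw [Nat.cast_ofNat]
  -- the four local factors and `λ₂(2)` in closed form
  have hcop1 : Nat.Coprime 2 1 := by decide
  have hcop2 : ¬ Nat.Coprime 2 2 := by decide
  have hG00 := calM2Factor_prime_eq c' χ Nat.prime_two 1 1 s hx1
  have hG01 := calM2Factor_prime_eq c' χ Nat.prime_two 1 2 s hx1
  have hG10 := calM2Factor_prime_eq c' χ Nat.prime_two 2 1 s hx1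
  have hG11 := calM2Factor_prime_eq c' χ Nat.prime_two 2 2 s hx1
  have hxz' : (2 : ℂ) ^ (-s) = z / 2 := by
    have h := hxz; rwa [Nat.cast_ofNat] at h
  simp only [if_pos hcop1, if_neg hcop2, Nat.cast_ofNat, AppendixA.locPref, AppendixA.locLam]
    at hG00 hG01 hG10 hG11
  rw [hxz', hv, ← hw] at hG00 hG01 hG10 hG11
  have hLam : lam2 c' χ 2 1 = (1 - w / 2) / (1 - 1 / 2) := by
    rw [Typed.Section16ALeaves.lam2_prime c' χ Nat.prime_two 1, hv']
    push_cast
    rw [one_mul, one_mul, neg_add, Complex.cpow_add _ _ two_ne_zero, Complex.cpow_neg_one, ← hw]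
    ring
  -- the seven coefficients `u_r = ϖ₂ⱼ(2^r)(ν∗χ)(2^r)`, `r ≤ 6`
  have hF : χ (2 : ZMod D) ≠ 1 → calM2Factor c' χ 2 1 1 s ≠ 0 := fun h => absurd hv h
  have hl1 : lam2 c' χ 1 1 = 1 := by
    have h := Lemma162R.lam2_prime_pow c' χ Nat.prime_two 0 1
    rwa [pow_zero, if_pos rfl] at h
  have hu0 : varpi2 c' χ j 1 * nuConvChi χ 1 = calM2Factor c' χ 2 1 1 s / 2 := by
    have h := varpi2_two_pow c' χ j 0 hstar hF
    rw [pow_zero, if_neg (not_not.mpr hv)] at h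
    rw [Lemma162R.nuConvChi_one, mul_one, h]
    simp only [Nat.divisorsAntidiagonal_one, Finset.sum_singleton, Nat.cast_one, map_one,
      Complex.one_cpow, mul_one, hl1, one_mul]
    ring
  have hur : ∀ r : ℕ, varpi2 c' χ j (2 ^ (1 + r)) * nuConvChi χ (2 ^ (1 + r)) =
      (1 / 2 : ℂ) * (calM2Factor c' χ 2 1 2 s +
        lam2 c' χ 2 1 * calM2Factor c' χ 2 2 2 s * (z * ∑ i ∈ Finset.range r, z ^ i) +
        lam2 c' χ 2 1 * calM2Factor c' χ 2 2 1 s * z ^ (1 + r)) *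
        (((r : ℂ) + 3) * ((r : ℂ) + 2) / 2) := by
    intro r
    have h2 := two_mul_varpi2_two_pow_of_apply_eq_one c' χ hv j hstar (e := 1 + r) (by omega)
    rw [sum_Ico_pow_shift z (le_refl 1) r, Finset.Ico_self, Finset.sum_empty, zero_add, pow_one] at h2
    rw [← hz, ← hs] at h2
    rw [nuConvChi_prime_pow_of_apply_eq_one χ Nat.prime_two hv' (1 + r), Nat.cast_choose_two]
    push_cast
    linear_combination (((r : ℂ) + 3) * ((r : ℂ) + 2) / 2 / 2) * h2
  have hu1 := hur 0
  have hu2 := hur 1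
  have hu3 := hur 2
  have hu4 := hur 3
  have hu5 := hur 4
  have hu6 := hur 5
  norm_num [Finset.sum_range_succ] at hu1 hu2 hu3 hu4 hu5 hu6
  -- expand the finite sum and substitute
  simp only [Finset.sum_range_succ, Finset.sum_range_zero, zero_add]
  norm_num
  rw [hu0, hu1, hu2, hu3, hu4, hu5, hu6, hG00, hG01, hG10, hG11, hLam, Complex.cpow_neg_one]
  field_simp
  ring

end StarValue


section StarBound

open Literature.NumberTheory.LFunctions.Zhang2022
open Literature.NumberTheory.LFunctions.Zhang2022.Skeleton
open Literature.NumberTheory.LFunctions.Zhang2022.Typed.Section16A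

/-- `‖n^w − 1‖ ≤ ‖w‖·log n` for a purely imaginary `w` and `n ≥ 1`. [folklore] -/
private theorem norm_natCast_cpow_sub_one_le_im'' {n : ℕ} (hn : 0 < n) {w : ℂ} (hw : w.re = 0) :
    ‖(n : ℂ) ^ w - 1‖ ≤ ‖w‖ * Real.log n := by
  have hn0 : (n : ℂ) ≠ 0 := by exact_mod_cast hn.ne'
  have him : w = ((w.im : ℝ) : ℂ) * I := by
    apply Complex.ext <;> simp [hw]
  have hnorm : ‖w‖ = |w.im| := by
    rw [congrArg (fun z : ℂ => ‖z‖) him]; simp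
  have e0 : (Real.log n : ℂ) * w = I * ((Real.log n * w.im : ℝ) : ℂ) := by
    apply Complex.ext <;> simp [hw]
  rw [Complex.cpow_def_of_ne_zero hn0, ← Complex.natCast_log, e0]
  calc ‖Complex.exp (I * ((Real.log n * w.im : ℝ) : ℂ)) - 1‖ ≤ ‖(Real.log n * w.im : ℝ)‖ :=
        Real.norm_exp_I_mul_ofReal_sub_one_le
    _ = ‖w‖ * Real.log n := by
        rw [Real.norm_eq_abs, abs_mul, abs_of_nonneg (Real.log_natCast_nonneg n), mul_comm, hnorm]

/-- `𝓛 ≥ M` once `D ≥ ⌈exp M⌉₊`. [cite: Zhang2022LandauSiegel, §2 (2.1)] -/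
private theorem le_ell_of_ceil_exp_le_star {M : ℝ} {D : ℕ} (hD : ⌈Real.exp M⌉₊ ≤ D) : M ≤ ell D := by
  have hDexp : Real.exp M ≤ D := le_trans (Nat.le_ceil _) (by exact_mod_cast hD)
  have hDpos : (0 : ℝ) < D := lt_of_lt_of_le (Real.exp_pos _) hDexp
  rw [ell]; exact (Real.le_log_iff_exp_le hDpos).mpr hDexp

/-- **D-2e, STAR branch (`χ(2) = 1`): the `2`-factor at `s = 1` is `3/8 + O(α)`** — for `D` large under
(A), `j ∈ {1,2}`: `‖N₂(½)·Σ_e ϖ₂ⱼ(2^e)(ν∗χ)(2^e)2^{−e} − 3/8‖ ≤ 10α` (from `twoFactor_star_eq`: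
`|2^{−β₁} − 1| ≤ |b₁|log 2 ≤ 2α`, `|2^{β_j} − 1| ≤ ‖β_j‖log 2 ≤ 5α`, `|Q₁(z)| ≤ 4`, `|2 − z| ≥ 1`).
[cite: Zhang2022LandauSiegel, §16 Lemma 16.2 p.94; App. A p.105] -/
theorem twoFactor_value_star (c' : ℝ) : ForAllLarge fun D _ χ => AssumptionA D χ →
    χ (2 : ZMod D) = 1 → ∀ j ∈ ({1, 2} : Finset ℕ),
      ‖((1 - (2 : ℂ) ^ (-(1 : ℂ))) ^ 3 * (1 - (2 : ℂ) ^ betaJ c' D j * (2 : ℂ) ^ (-(1 : ℂ))) ^ 3) *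
          (∑' e : ℕ, varpi2 c' χ j (2 ^ e) * nuConvChi χ (2 ^ e) * ((2 : ℂ) ^ (-(1 : ℂ))) ^ e) -
        3 / 8‖ ≤ 10 * alpha D := by
  obtain ⟨D₁, hD₁⟩ := two_data_ne_zero c'
  obtain ⟨B, D₂, hD₂⟩ := norm_varpi2_two_pow_le c'
  refine ForAllLarge.of_le (max (max D₁ D₂) ⌈Real.exp (Real.pi * (5 * |c'| + 1) + 2)⌉₊)
    fun D _ χ hD hq hprim hA hv j hj => ?_
  have hDD₁ : D₁ ≤ D := le_trans (le_trans (le_max_left _ _) (le_max_left _ _)) hD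
  have hDD₂ : D₂ ≤ D := le_trans (le_trans (le_max_right _ _) (le_max_left _ _)) hD
  have hℓ : Real.pi * (5 * |c'| + 1) + 2 ≤ ell D :=
    le_ell_of_ceil_exp_le_star (le_trans (le_max_right _ _) hD)
  have hπ3 := Real.pi_gt_three
  have hℓ2 : 2 ≤ ell D := by nlinarith [abs_nonneg c', Real.pi_pos]
  have hℓπ : Real.pi * (5 * |c'| + 1) ≤ ell D := by linarith
  obtain ⟨hstar, -⟩ := hD₁ D χ hDD₁ hq hprim hA j hj
  have hB := hD₂ D χ hDD₂ hq hprim hA j hj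
  rw [twoFactor_star_eq c' χ hv j hstar hB, add_sub_cancel_left]
  -- sizes
  set z : ℂ := (2 : ℂ) ^ betaJ c' D j with hz
  set w : ℂ := (2 : ℂ) ^ (-beta1 c' D) with hw
  have hα0 : 0 < alpha D := by rw [alpha, bigP, Real.log_exp]; positivity
  have hlog2 : Real.log 2 ≤ 1 := by
    have := Real.log_two_lt_d9; linarith
  have hlog2' : 0 ≤ Real.log 2 := Real.log_nonneg (by norm_num)
  have hβj : ‖betaJ c' D j‖ < 5 * alpha D := norm_betaJ_lt_five_alpha hℓ2 hℓπ hj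
  have hznorm : ‖z‖ = 1 := by
    rw [hz, show (2 : ℂ) = ((2 : ℕ) : ℂ) by norm_num,
      Complex.norm_natCast_cpow_of_pos (by norm_num : 0 < 2), betaJ_re_eq_zero c' D j, Real.rpow_zero]
  have hz1 : ‖z - 1‖ ≤ 5 * alpha D := by
    have h := norm_natCast_cpow_sub_one_le_im'' (n := 2) (by norm_num) (w := betaJ c' D j)
      (betaJ_re_eq_zero c' D j)
    rw [Nat.cast_ofNat] at h
    calc ‖z - 1‖ ≤ ‖betaJ c' D j‖ * Real.log 2 := h
      _ ≤ (5 * alpha D) * 1 := mul_le_mul hβj.le hlog2 hlog2' (by positivity)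
      _ = 5 * alpha D := by ring
  -- `|b₁| ≤ 2α` (as `5|c′|α𝓛 ≤ 1`)
  have hαℓ : alpha D * ell D * (5 * |c'| + 1) ≤ 1 := by
    have hα : alpha D = Real.pi / ell D ^ 9 := by rw [alpha, bigP, Real.log_exp]
    have hℓ1 : 1 ≤ ell D := by linarith
    have hℓ0 : 0 < ell D := by linarith
    have h8 : ell D ≤ ell D ^ 8 := le_self_pow₀ hℓ1 (by norm_num)
    have hpos : 0 < ell D ^ 9 := by positivity
    have e9 : ell D ^ 9 = ell D ^ 8 * ell D := by ring
    rw [hα, div_mul_eq_mul_div, div_mul_eq_mul_div, div_le_iff₀ hpos, one_mul, e9]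
    have hc0 : 0 ≤ 5 * |c'| + 1 := by positivity
    calc Real.pi * ell D * (5 * |c'| + 1) = (Real.pi * (5 * |c'| + 1)) * ell D := by ring
      _ ≤ ell D * ell D := by gcongr
      _ ≤ ell D ^ 8 * ell D := by gcongr
  have hb1 : |b1 c' D| ≤ 2 * alpha D := by
    rw [b1, abs_mul, abs_of_pos hα0]
    have hc : |5 * c' * alpha D * ell D| ≤ 1 := by
      rw [show 5 * c' * alpha D * ell D = c' * (5 * (alpha D * ell D)) by ring, abs_mul,
        abs_of_pos (by positivity : 0 < 5 * (alpha D * ell D))]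
      nlinarith [abs_nonneg c', hα0, (show 0 < ell D by linarith)]
    have : |1 - 5 * c' * alpha D * ell D| ≤ 2 := by
      calc |1 - 5 * c' * alpha D * ell D| ≤ |(1 : ℝ)| + |5 * c' * alpha D * ell D| := abs_sub _ _
        _ ≤ 1 + 1 := by rw [abs_one]; linarith
        _ = 2 := by norm_num
    nlinarith [abs_nonneg (1 - 5 * c' * alpha D * ell D)]
  have hw1 : ‖w - 1‖ ≤ 2 * alpha D := by
    obtain ⟨-, h⟩ := AppendixA.norm_cpow_neg_beta1 c' (D := D) (q := 2) (by norm_num)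
    rw [Nat.cast_ofNat] at h
    calc ‖w - 1‖ ≤ |b1 c' D| * Real.log 2 := h
      _ ≤ (2 * alpha D) * 1 := mul_le_mul hb1 hlog2 hlog2' (by positivity)
      _ = 2 * alpha D := by ring
  -- the pieces of the closed form
  have hQ : ‖z / 2 * (1 - z / 2) ^ 2 - (1 - z) / 8 + (1 - 7 * z + 5 * z ^ 2 - z ^ 3) / 8‖ ≤ 4 := by
    have hz2' : ‖z / 2‖ = 1 / 2 := by rw [norm_div, hznorm, Complex.norm_ofNat]
    have h1mz2 : ‖1 - z / 2‖ ≤ 3 / 2 := by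
      calc ‖1 - z / 2‖ ≤ ‖(1 : ℂ)‖ + ‖z / 2‖ := norm_sub_le _ _
        _ = 3 / 2 := by rw [norm_one, hz2']; norm_num
    have h1 : ‖z / 2 * (1 - z / 2) ^ 2‖ ≤ 1 / 2 * (3 / 2) ^ 2 := by
      rw [norm_mul, norm_pow, hz2']
      gcongr
    have h1z : ‖1 - z‖ ≤ 2 := by
      calc ‖1 - z‖ ≤ ‖(1 : ℂ)‖ + ‖z‖ := norm_sub_le _ _
        _ = 2 := by rw [norm_one, hznorm]; norm_num
    have h2 : ‖(1 - z) / 8‖ ≤ 2 / 8 := by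
      rw [norm_div, Complex.norm_ofNat]; gcongr
    have hn7 : ‖7 * z‖ = 7 := by rw [norm_mul, hznorm, Complex.norm_ofNat]; norm_num
    have hn5 : ‖5 * z ^ 2‖ = 5 := by rw [norm_mul, norm_pow, hznorm, Complex.norm_ofNat]; norm_num
    have hn3 : ‖z ^ 3‖ = 1 := by rw [norm_pow, hznorm]; norm_num
    have hpoly : ‖1 - 7 * z + 5 * z ^ 2 - z ^ 3‖ ≤ 14 := by
      have a1 := norm_sub_le (1 - 7 * z + 5 * z ^ 2) (z ^ 3)
      have a2 := norm_add_le (1 - 7 * z) (5 * z ^ 2)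
      have a3 := norm_sub_le (1 : ℂ) (7 * z)
      rw [norm_one] at a3
      linarith
    have h3 : ‖(1 - 7 * z + 5 * z ^ 2 - z ^ 3) / 8‖ ≤ 14 / 8 := by
      rw [norm_div, Complex.norm_ofNat]; gcongr
    have b1 := norm_sub_le (z / 2 * (1 - z / 2) ^ 2) ((1 - z) / 8)
    have b2 := norm_add_le (z / 2 * (1 - z / 2) ^ 2 - (1 - z) / 8) ((1 - 7 * z + 5 * z ^ 2 - z ^ 3) / 8)
    linarith
  have h2z : 1 ≤ ‖2 - z‖ := by
    have := norm_sub_norm_le (2 : ℂ) z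
    rw [Complex.norm_ofNat, hznorm] at this
    linarith
  have hz2 : ‖z - 2‖ ≤ 3 := by
    calc ‖z - 2‖ ≤ ‖z‖ + ‖(2 : ℂ)‖ := norm_sub_le _ _
      _ = 3 := by rw [hznorm, Complex.norm_ofNat]; norm_num
  -- assemble
  rw [norm_div]
  rw [div_le_iff₀ (by linarith)]
  calc ‖(w - 1) * (z / 2 * (1 - z / 2) ^ 2 - (1 - z) / 8 + (1 - 7 * z + 5 * z ^ 2 - z ^ 3) / 8) +
        (z - 1) * (z - 2) / 8‖
      ≤ ‖(w - 1) * (z / 2 * (1 - z / 2) ^ 2 - (1 - z) / 8 + (1 - 7 * z + 5 * z ^ 2 - z ^ 3) / 8)‖ +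
          ‖(z - 1) * (z - 2) / 8‖ := norm_add_le _ _
    _ ≤ (2 * alpha D) * 4 + (5 * alpha D) * 3 / 8 := by
        rw [norm_mul, norm_div, norm_mul, Complex.norm_ofNat]
        gcongr
    _ ≤ 10 * alpha D * 1 := by nlinarith
    _ ≤ 10 * alpha D * ‖2 - z‖ := by gcongr

end StarBound

end Literature.NumberTheory.LFunctions.Zhang2022.Typed.Section16B

end
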